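import Literature.NumberTheory.EllipticCurves.H1SigmaDualFiniteProofs
import Literature.NumberTheory.EllipticCurves.SelmerInftyTorsionFiniteProofs
import Literature.NumberTheory.EllipticCurves.SelmerCorankProofs
import HarnessLib

/-!
# Kummer for the `p`-torsion `M[p] ↪ M` of a discrete module over a subgroup `H ≤ Γ_K`:
# FINITE KERNEL of `H¹(H, M[p]) → H¹(H, M)`, and (B′) the unramified condition pulls back to `M[p]`
# (helper for crux stmt-BirchSwinnertonDyer-20368 `PrintCf2.SplitBadTwoRankOneOfFacts`, leaf (F1-fg) of the
# S3n′ divisibility road; cell `bsd-print-cf2`, width seat `bsd-line-cf2-p1-w5` g5)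

The E[p^∞]-pattern of `SelmerInftyTorsionFiniteProofs` (`finite_ker_torsionToPrimaryH1Sub`) and
`H1SigmaDualFiniteProofs` §1 (`resOfLe_eq_zero_of_mem_unramifiedOutside`), rewritten for an ARBITRARY
discrete `p`-primary module — so that it applies to Keller–Yin's character module `(F/𝓞)(θ) ≃ ℚ_p/ℤ_p(θ)`
(next file, `PrintCf2SplitBadTwoUnrAmbientDualModuleFinite.lean`):

* §1 `finite_ker_resH1Hom_torsionBy` — for a topological group `G` acting on a discrete `p`-primary `B`
  with `B[p]` finite and continuous orbit maps, the kernel of `j_* : H¹(G, B[p]) → H¹(G, B)` (`j` the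
  inclusion) is FINITE: a kernel class is `[∂b]` with `p b ∈ B^G`, and it only depends on `p b` modulo
  `p B^G`; `B^G/pB^G` is finite by the pigeonhole `ResKernel.finite_quotient_range_of_finite_ker` over the
  finite stable pieces `B^G[pⁿ]` (`finite_torsionBy_pow`).
* §2 `resOfLe_torsionBy_eq_zero_of_mem_unramifiedOutside` — (B′) for `H ≤ Γ_K` normal and a finite place
  `v ∤ p`, `v ∉ S₀`, at which EVERY inertia group `I_𝔓`, `𝔓 ∣ v`, acts trivially on `M`: if
  `j_* y ∈ unramifiedOutside H M p S₀` (Greenberg–Vatsal's `H¹(K_Σ/L, M)`, unramified at the CHOSEN place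
  above each such `v` for every conjugate) then `y ∈ H¹(H, M[p])` restricts to `0` on every `I_𝔓 ≤ H`,
  `𝔓 ∣ v` (transport to the chosen prime `𝔓 = g • 𝔓₀` — `exists_smul_eq_of_mem_primesAbove_holds`,
  `mem_inertia_smul_absIntegers_iff`, the condition for `conj_{g⁻¹}` — local–global inertia
  `exists_mem_inertia_apply_eq_holds` (Neukirch II (9.6)), and triviality of `I_{𝔓₀}` on `M`, which kills
  the coboundary a merely unramified class leaves).

Theorems only; no definition, no named fact, no `sorry`, no instance.  HONEST FRAMING: cohomological
bookkeeping; closes nothing by itself (`--supports`); no summit statement / BSD / the crux is proved here.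

References: [GreenbergLNM1716] §1 p. 60, §3 Lemma 3.1 (proof), §4 p. 117; [SilvermanAEC2009] Cor. X.4.4;
[NeukirchANT1999] II (9.6); [SerreGaloisCohomology1997] I §2.2 Prop. 2, I §2.4–2.5.
-/

set_option autoImplicit false
set_option linter.dupNamespace false -- `Summit.BirchSwinnertonDyer.BirchSwinnertonDyer` (summit = problem) is the tree's layout

noncomputable section

open scoped Classical AddSubgroup Pointwise
open CategoryTheory NumberField IsDedekindDomain Field
open Literature.NumberTheory.EllipticCurves Literature.NumberTheory.EllipticCurves.GreenbergSelmer
  Literature.NumberTheory.EllipticCurves.GreenbergVatsal2000 Literature.NumberTheory.GaloisRepresentations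

universe u

namespace Summit.BirchSwinnertonDyer.BirchSwinnertonDyer.Theorems.PrintCf2.UnrAmbientDual

/-! ## §1. The kernel of `H¹(G, B[p]) → H¹(G, B)` is finite -/

section Kernel

variable {G : Type u} [Group G] [TopologicalSpace G] [IsTopologicalGroup G]
variable {B : Type u} [AddCommGroup B] [DistribMulAction G B] [TopologicalSpace B] [DiscreteTopology B]
variable {p : ℕ}

/-- **The kernel of `j_* : H¹(G, B[p]) → H¹(G, B)` is finite** for a discrete `p`-primary `G`-module `B`
with `B[p]` finite and continuous orbit maps (`j : B[p] ↪ B` the inclusion).  A kernel class is `[∂b]`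
with `p b = β ∈ B^G` (`b` "admissible"); two admissible `b`'s differing by `B^G + B[p]` give the same class,
so the kernel is the image of `B^G/pB^G`, finite by the pigeonhole
`ResKernel.finite_quotient_range_of_finite_ker` over the finite stable pieces `B^G[pⁿ] ⊆ B[pⁿ]`
(`finite_torsionBy_pow`) with `ker p = B^G[p]` finite — verbatim the tree's
`WeierstrassCurve.finite_ker_torsionToPrimaryH1Sub` with `E[p^∞]` replaced by `B`.
[cite: GreenbergLNM1716, §3 proof of Lemma 3.1 (`B = E(F_∞)[p^∞]`)] [cite: SerreGaloisCohomology1997, I §2.2 Prop. 2] -/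
theorem finite_ker_resH1Hom_torsionBy [Finite (B[(p : ℤ)])]
    (htors : ∀ b : B, ∃ k : ℕ, p ^ k • b = 0) (hcont : ∀ b : B, Continuous fun g : G ↦ g • b) :
    Set.Finite ((resH1Hom (ContinuousMonoidHom.id G) (B[(p : ℤ)]).subtype (fun _ _ ↦ rfl) :
      discreteH1 G (B[(p : ℤ)]) →+ discreteH1 G B).ker : Set (discreteH1 G (B[(p : ℤ)]))) := by
  -- `B' = B^G`
  let B' : AddSubgroup B := FixedPoints.addSubgroup G B
  -- `B'/pB'` is finite
  let mulp : B' →+ B' := DistribSMul.toAddMonoidHom B' (p : ℕ)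
  have hfinq : Finite (B' ⧸ mulp.range) := by
    haveI : Finite mulp.ker := by
      refine Finite.of_injective (fun b ↦ (⟨((b : B') : B), ?_⟩ : B[(p : ℤ)])) ?_
      · rw [AddSubgroup.torsionBy.nsmul_iff]
        have := (AddMonoidHom.mem_ker).mp b.2
        exact congrArg (fun z : B' ↦ (z : B)) this
      · intro a b hab
        apply Subtype.ext; apply Subtype.ext
        exact congrArg (fun z : B[(p : ℤ)] ↦ (z : B)) hab
    refine (ResKernel.finite_quotient_range_of_finite_ker mulp
      (fun n ↦ AddSubgroup.torsionBy _ (p ^ n : ℕ)) (fun m n hmn ↦ ?_) (fun b ↦ ?_) (fun n ↦ ?_)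
      (fun n b hb ↦ ?_)).1
    · intro b hb
      rw [AddSubgroup.torsionBy.nsmul_iff] at hb ⊢
      obtain ⟨c, hc⟩ := Nat.pow_dvd_pow p hmn
      rw [hc, Nat.mul_comm (p ^ m) c, ← smul_smul, hb, smul_zero]
    · obtain ⟨n, hn⟩ := htors ((b : B') : B)
      refine ⟨n, ?_⟩
      rw [AddSubgroup.torsionBy.nsmul_iff]
      apply Subtype.ext
      simpa using hn
    · haveI := finite_torsionBy_pow B p n
      refine Finite.of_injective (fun b ↦ (⟨((b : B') : B), ?_⟩ : B[((p ^ n : ℕ) : ℤ)])) ?_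
      · have hb := AddSubgroup.torsionBy.nsmul_iff.mp b.2
        rw [AddSubgroup.torsionBy.nsmul_iff]
        exact congrArg (fun z : B' ↦ (z : B)) hb
      · intro a b hab
        apply Subtype.ext; apply Subtype.ext
        exact congrArg (fun z : B[((p ^ n : ℕ) : ℤ)] ↦ (z : B)) hab
    · rw [AddSubgroup.torsionBy.nsmul_iff] at hb ⊢
      rw [← map_nsmul, hb, map_zero]
  -- admissible `p`-th roots and their Kummer classes in `H¹(G, B[p])`
  let incl : B[(p : ℤ)] →+ B := (B[(p : ℤ)]).subtype
  have hincl : ∀ (g : G) (s : B[(p : ℤ)]), incl (ContinuousMonoidHom.id G g • s) = g • incl s :=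
    fun _ _ ↦ rfl
  have hmemB : ∀ (b : B), (∀ σ : G, σ • (p • b) = p • b) → ∀ σ : G, σ • b - b ∈ B[(p : ℤ)] := by
    intro b hb σ
    refine AddSubgroup.torsionBy.nsmul_iff.mpr ?_
    rw [smul_sub, smul_comm, hb σ, sub_self]
  let coc : ∀ (b : B), (∀ σ : G, σ • (p • b) = p • b) → contOneCocycles (discreteTopRep G (B[(p : ℤ)])) :=
    fun b hb ↦ contOneCocycles.lift incl hincl (B[(p : ℤ)]).subtype_injective (cobCocycle b (hcont b))
      (fun σ ↦ ⟨_, hmemB b hb σ⟩) (fun _ ↦ rfl)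
  have hcoc : ∀ b hb (σ : G), (((coc b hb).1 σ : B[(p : ℤ)]) : B) = σ • b - b := fun _ _ _ ↦ rfl
  -- two admissible roots differing by `B' + B[p]` give the same class
  have hcls : ∀ (b₁ b₂ : B) (hb₁ : ∀ σ : G, σ • (p • b₁) = p • b₁) (hb₂ : ∀ σ : G, σ • (p • b₂) = p • b₂)
      (β : B), (∀ σ : G, σ • β = β) → p • (b₁ - b₂ - β) = 0 →
      oneCocycleClass _ (coc b₁ hb₁) = oneCocycleClass _ (coc b₂ hb₂) := by
    intro b₁ b₂ hb₁ hb₂ β hβ hpe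
    have he : b₁ - b₂ - β ∈ B[(p : ℤ)] := AddSubgroup.torsionBy.nsmul_iff.mpr hpe
    rw [← sub_eq_zero, ← oneCocycleClass_sub, oneCocycleClass_eq_zero_iff]
    refine ⟨⟨_, he⟩, fun σ ↦ ?_⟩
    apply Subtype.ext
    change (((coc b₁ hb₁).1 σ - (coc b₂ hb₂).1 σ : B[(p : ℤ)]) : B) = _
    rw [AddSubgroupClass.coe_sub, hcoc b₁ hb₁, hcoc b₂ hb₂]
    change _ = σ • (b₁ - b₂ - β) - (b₁ - b₂ - β)
    rw [smul_sub, smul_sub, hβ]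
    abel
  -- every kernel element is the class of an admissible root
  have hker : ∀ x ∈ (resH1Hom (ContinuousMonoidHom.id G) incl hincl).ker,
      ∃ b hb, x = oneCocycleClass _ (coc b hb) := by
    intro x hx
    obtain ⟨φ, rfl⟩ := oneCocycleClass_surjective _ x
    rw [AddMonoidHom.mem_ker, resH1Hom_id_oneCocycleClass, oneCocycleClass_eq_zero_iff] at hx
    obtain ⟨b, hb⟩ := hx
    have hb' : ∀ σ : G, incl (φ.1 σ) = σ • b - b := fun σ ↦ hb σ
    have hadm : ∀ σ : G, σ • (p • b) = p • b := fun σ ↦ by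
      have h1 : p • (σ • b - b) = 0 := by
        rw [← hb' σ, ← map_nsmul, AddSubgroup.torsionBy.nsmul (φ.1 σ), map_zero]
      rw [smul_sub, smul_comm, sub_eq_zero] at h1
      exact h1
    refine ⟨b, hadm, congrArg _ (Subtype.ext (ContinuousMap.ext fun σ ↦ ?_))⟩
    apply (B[(p : ℤ)]).subtype_injective
    change incl (φ.1 σ) = incl ((coc b hadm).1 σ)
    rw [hb' σ]
    rfl
  -- roots: each `β ∈ B'` of the form `p • b` is handled through the quotient `B'/pB'`
  -- (classes with no admissible root do not occur: `β = p b` by construction below)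
  let f : B' ⧸ mulp.range → Set (discreteH1 G (B[(p : ℤ)])) := fun q ↦
    {x | ∃ b hb, x = oneCocycleClass _ (coc b hb) ∧ (QuotientAddGroup.mk ⟨p • b, hb⟩ : B' ⧸ mulp.range) = q}
  -- each fibre has at most one element
  have hf : ∀ q, (f q).Subsingleton := by
    rintro q x ⟨b₁, hb₁, rfl, hq₁⟩ y ⟨b₂, hb₂, rfl, hq₂⟩
    rw [← hq₂, QuotientAddGroup.eq] at hq₁
    obtain ⟨β', hβ'⟩ := hq₁
    -- `-(p b₁) + p b₂ = p β'` with `β' ∈ B'`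
    have hβ'eq : p • ((β' : B') : B) = -(p • b₁) + p • b₂ := by
      have := congrArg (fun z : B' ↦ (z : B)) hβ'
      simpa [mulp] using this
    refine hcls b₁ b₂ hb₁ hb₂ (-(β' : B)) (fun σ ↦ by rw [smul_neg, (β' : B').2 σ]) ?_
    rw [sub_neg_eq_add, smul_add, smul_sub, hβ'eq]
    abel
  haveI : Finite (B' ⧸ mulp.range) := hfinq
  refine ((Set.finite_iUnion fun q ↦ (hf q).finite)).subset fun x hx ↦ ?_
  obtain ⟨b, hb, rfl⟩ := hker x hx
  exact Set.mem_iUnion.mpr ⟨QuotientAddGroup.mk ⟨p • b, hb⟩, b, hb, rfl, rfl⟩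

end Kernel

/-! ## §2. (B′) Classes unramified at the chosen place (for all conjugates) vanish on every `I_𝔓` -/

section Unramified

variable {K : Type u} [Field K] [NumberField K] {p : ℕ} [Fact p.Prime]
  {H : Subgroup (absoluteGaloisGroup K)} [H.Normal]
  {M : Type u} [AddCommGroup M] [DistribMulAction (absoluteGaloisGroup K) M] [TopologicalSpace M]
  [DiscreteTopology M]

omit [Fact p.Prime] [H.Normal] in
/-- Cocycle criterion for `unramifiedKer` (same body as the E-pattern's private lemma): the class of `f`
is unramified at the chosen place above `v` iff `f` is principal on `H ⊓ I_v`. [folklore] -/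
theorem oneCocycleClass_mem_unramifiedKer_iff (v : HeightOneSpectrum (𝓞 K))
    (f : contOneCocycles (discreteTopRep H M)) :
    oneCocycleClass (discreteTopRep H M) f ∈ unramifiedKer H M v ↔
      ∃ m : M, ∀ x : inertiaIn H v, f.1 (inertiaInToH H v x) = x • m - m := by
  rw [GreenbergVatsal2000.unramifiedKer, AddMonoidHom.mem_ker,
    CocycleCriteria.resH1Hom_oneCocycleClass_eq_zero_iff]
  rfl

omit [Fact p.Prime] in
/-- **(B′) for an arbitrary discrete module.**  Let `H ≤ Γ_K` be normal, `v ∉ S₀` a finite place with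
`v ∤ p` such that EVERY inertia group `I_𝔓 ≤ Γ_K`, `𝔓 ∣ v`, acts trivially on `M`.  If the image in
`H¹(H, M)` of `y ∈ H¹(H, M[p])` lies in `unramifiedOutside H M p S₀` (unramified at the chosen place above
`v` for every conjugate), then `y` restricts to `0` on every `I_𝔓 ≤ H`, `𝔓 ∣ v`: transport to the prime of
the chosen embedding (`𝔓 = g • 𝔓₀`, the condition for `conj_{g⁻¹}`), lift `g⁻¹ τ g ∈ I_{𝔓₀}` to the local
inertia group (Neukirch II (9.6)) to see it in the chosen `I_v ⊓ H`, and use that `I_{𝔓₀}` fixes the point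
`b` of the coboundary a merely unramified class leaves, so that `φ(τ) = 0`.  Verbatim the tree's
`WeierstrassCurve.resOfLe_eq_zero_of_mem_unramifiedOutside` with «good reduction at `v ∤ p`» replaced by
«`I_𝔓` acts trivially on `M`». [cite: SilvermanAEC2009, Cor. X.4.4] [cite: NeukirchANT1999, Ch. II §9 Prop. (9.6)]
[cite: GreenbergVatsal2000, §2 pp. 16–17] -/
theorem resOfLe_torsionBy_eq_zero_of_mem_unramifiedOutside {S₀ : Set (HeightOneSpectrum (𝓞 K))}
    {y : subgroupH1 H (M[(p : ℤ)])}
    (hy : resH1Hom (ContinuousMonoidHom.id H) (M[(p : ℤ)]).subtype (fun _ _ ↦ rfl) y ∈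
      unramifiedOutside H M p S₀)
    {v : HeightOneSpectrum (𝓞 K)} (hvS : v ∉ S₀) (hpv : ((p : ℕ) : 𝓞 K) ∉ v.asIdeal)
    (hI : ∀ 𝔓 ∈ v.primesAbove, ∀ σ ∈ 𝔓.inertia (absoluteGaloisGroup K), ∀ m : M, σ • m = m)
    {𝔓 : Ideal (absIntegers (𝓞 K) K)} (h𝔓 : 𝔓 ∈ v.primesAbove)
    (hle : 𝔓.inertia (absoluteGaloisGroup K) ≤ H) :
    resOfLe (M[(p : ℤ)]) hle y = 0 := by
  obtain ⟨φ, rfl⟩ := oneCocycleClass_surjective _ y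
  -- base prime `𝔓₀` from the chosen embedding and a local prime `𝔐`, and `g` with `g • 𝔓₀ = 𝔓`
  obtain ⟨𝔐, h𝔐⟩ := v.localPrimesAbove_nonempty
  obtain ⟨w, hw⟩ := v.exists_spectralValuation
  set ι₀ := closureEmb (K := K) (v.adicCompletion K) with hι₀
  obtain ⟨g, hg⟩ := HeightOneSpectrum.exists_smul_eq_of_mem_primesAbove_holds
    (HeightOneSpectrum.primeBelow_mem_primesAbove (ι := ι₀) h𝔐) h𝔓
  -- the unramified condition at `v`, conjugated by `g⁻¹`
  have hunr := (mem_unramifiedOutside_iff _).mp hy v hvS hpv g⁻¹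
  rw [resH1Hom_id_oneCocycleClass] at hunr
  -- cocycle-level form of `conj_{g⁻¹}`
  have hc : ∀ (x : H) (m : M),
      DistribSMul.toAddMonoidHom _ g⁻¹ (subgroupConj H g⁻¹ x • m) =
        x • DistribSMul.toAddMonoidHom _ g⁻¹ m := fun x m ↦ by
    simp only [DistribSMul.toAddMonoidHom_apply, Subgroup.smul_def, subgroupConj_apply_coe,
      smul_smul, mul_assoc, mul_inv_cancel_left]
  set ψ := contOneCocycles.push (M[(p : ℤ)]).subtype (fun _ _ ↦ rfl) φ with hψ
  have hconj : conjH1 H M g⁻¹ (oneCocycleClass _ ψ) = oneCocycleClass _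
      (contOneCocycles.pullback (subgroupConj H g⁻¹)
        (resHomOfEquivariant (subgroupConj H g⁻¹) (DistribSMul.toAddMonoidHom _ g⁻¹) hc) ψ) :=
    map_oneCocycleClass _ _ _ ψ
  have hunr' : oneCocycleClass _ (contOneCocycles.pullback (subgroupConj H g⁻¹)
        (resHomOfEquivariant (subgroupConj H g⁻¹) (DistribSMul.toAddMonoidHom _ g⁻¹) hc) ψ) ∈
      unramifiedKer H M v := by
    rw [← hconj]; exact hunr
  -- principal on `H ⊓ I_v`: `∃ b, ψ'(x) = x • b - b`
  obtain ⟨b, hb⟩ := (oneCocycleClass_mem_unramifiedKer_iff v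
    (contOneCocycles.pullback (subgroupConj H g⁻¹)
      (resHomOfEquivariant (subgroupConj H g⁻¹) (DistribSMul.toAddMonoidHom _ g⁻¹) hc) ψ)).mp hunr'
  -- goal: `φ` vanishes on `I_𝔓`
  have hvan : ∀ τ : absoluteGaloisGroup K, ∀ hτ : τ ∈ 𝔓.inertia (absoluteGaloisGroup K),
      φ.1 ⟨τ, hle hτ⟩ = 0 := by
    intro τ hτ
    -- `σ₀ = g⁻¹ τ g ∈ I_{𝔓₀}` and a local `σ'` above it
    have hσ₀ : g⁻¹ * τ * g ∈ (v.primeBelow ι₀ 𝔐).inertia (absoluteGaloisGroup K) := by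
      rw [← HeightOneSpectrum.mem_inertia_smul_absIntegers_iff, hg]; exact hτ
    obtain ⟨σ', hσ'I, hσ'⟩ :=
      HeightOneSpectrum.exists_mem_inertia_apply_eq_holds v ι₀ h𝔐 hσ₀
    have hres : resGalOfEmb ι₀ σ' = g⁻¹ * τ * g := resGalOfEmb_eq_of_apply_eq ι₀ hσ'
    have hσ₀H : g⁻¹ * τ * g ∈ H := by
      have := Subgroup.Normal.conj_mem inferInstance τ (hle hτ) g⁻¹
      simpa using this
    -- `σ₀ ∈ D_v` and `σ₀ ∈ I_v` (the groups of the CHOSEN embedding)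
    have habs : absGaloisRestrict K (v.adicCompletion K) σ' = g⁻¹ * τ * g := by
      rw [← WeierstrassCurve.resGal_eq_absGaloisRestrict, resGal_eq, ← hι₀]; exact hres
    have hσ'abs : σ' ∈ absInertia (v.adicCompletion K) := by
      rw [← IsDedekindDomain.HeightOneSpectrum.inertia_eq_absInertia hw h𝔐]; exact hσ'I
    have hdec : g⁻¹ * τ * g ∈ decomp (K := K) v := ⟨σ', habs⟩
    have hin : g⁻¹ * τ * g ∈ inertia (K := K) v := Subgroup.mem_map.2 ⟨σ', hσ'abs, habs⟩
    let x₀ : inertiaIn H v := ⟨⟨g⁻¹ * τ * g, hdec⟩, (mem_inertiaIn_iff H v _).2 ⟨hσ₀H, hin⟩⟩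
    have key := hb x₀
    -- unfold the pulled-back cocycle at `x₀`
    have e0 : subgroupConj H g⁻¹ (inertiaInToH H v x₀) = ⟨τ, hle hτ⟩ :=
      Subtype.ext (by
        rw [subgroupConj_apply_coe]
        change g⁻¹⁻¹ * (g⁻¹ * τ * g) * g⁻¹ = τ
        group)
    have e1 : (contOneCocycles.pullback (subgroupConj H g⁻¹)
        (resHomOfEquivariant (subgroupConj H g⁻¹) (DistribSMul.toAddMonoidHom _ g⁻¹) hc) ψ).1
          (inertiaInToH H v x₀) =
        g⁻¹ • (M[(p : ℤ)]).subtype (φ.1 ⟨τ, hle hτ⟩) := by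
      rw [contOneCocycles.pullback_apply, e0]
      rfl
    rw [e1] at key
    -- `x₀ • b = σ₀ • b = b`: `I_{𝔓₀}` acts trivially on `M`
    have hx₀b : x₀ • b = (g⁻¹ * τ * g) • b := rfl
    have hbb : (g⁻¹ * τ * g) • b = b :=
      hI _ (HeightOneSpectrum.primeBelow_mem_primesAbove (ι := ι₀) h𝔐) _ hσ₀ b
    rw [hx₀b, hbb, sub_self] at key
    -- injectivity of the inclusion
    have h2 : (M[(p : ℤ)]).subtype (φ.1 ⟨τ, hle hτ⟩) = 0 := by
      rwa [smul_eq_zero_iff_eq] at key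
    exact (injective_iff_map_eq_zero _).mp (M[(p : ℤ)]).subtype_injective _ h2
  -- conclude: the restriction to `I_𝔓` is the class of the zero cocycle
  have hmap : resOfLe (M[(p : ℤ)]) hle (oneCocycleClass _ φ) = oneCocycleClass _
      (contOneCocycles.pullback (subgroupInclusion hle)
        (resHomOfEquivariant (subgroupInclusion hle) (AddMonoidHom.id (M[(p : ℤ)]))
          (fun _ _ ↦ rfl)) φ) :=
    map_oneCocycleClass _ _ _ φ
  rw [hmap, oneCocycleClass_eq_zero_iff]
  refine ⟨0, fun τ ↦ ?_⟩
  rw [contOneCocycles.pullback_apply, map_zero, sub_zero]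
  exact hvan τ τ.2

end Unramified

end Summit.BirchSwinnertonDyer.BirchSwinnertonDyer.Theorems.PrintCf2.UnrAmbientDual

end
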